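import Mathlib

/-!
# Sketch — crux-ideate r2 k6, crux `TwinSimilitudeAlgebraic` (stmt-HodgeConjecture-13674)
First lemmas of the line `pfister-square-modular-moduli` (pure bilinear algebra; all proved).
-/

namespace Summit.HodgeConjecture.HodgeConjecture.Cruxes.TwinSimilitudeAlgebraic.PfisterSquare

/-- **Pfister doubling (2 = 1² + 1²).** If `χ : V → V'` doubles the form (`B'(χu,χv) = 2·B(u,v)`,
e.g. `χ = ψ†` for a 2-similitude `ψ : V' → V`), then `u ↦ (χu/2, χu/2)` is an ISOMETRIC embedding of
`(V,B)` into the orthogonal sum `(V',B') ⊥ (V',B')`: the twin's `T(S)` sits isometrically (diagonally)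
inside `H²(S'×S') = H²(S') ⊕ H²(S')`. -/
theorem pfisterDoubling {K V V' : Type*} [Field K] [AddCommGroup V] [Module K V]
    [AddCommGroup V'] [Module K V'] (B : LinearMap.BilinForm K V) (B' : LinearMap.BilinForm K V')
    (χ : V →ₗ[K] V') (hχ : ∀ u v, B' (χ u) (χ v) = 2 * B u v) (h2 : (2 : K) ≠ 0) (u v : V) :
    B' ((2 : K)⁻¹ • χ u) ((2 : K)⁻¹ • χ v) + B' ((2 : K)⁻¹ • χ u) ((2 : K)⁻¹ • χ v) = B u v := by
  simp only [map_smul, LinearMap.smul_apply, smul_eq_mul, hχ]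
  field_simp
  ring

/-- **Conformal-factor detector.** Let `ψ₀ : T(M) → T(S')` be the Hodge similitude of multiplier `r₀`
between a 2-dimensional moduli space `M` of objects on `X = S'^{[2]}` and `S'`, and let the
cohomological Fourier–Mukai map send `x ∈ T(M)` to `ψ₀ x ⊗ u` in the `T(S')`-isotypic part
`T(S') ⊗ U` of the Mukai lattice of `X`, whose form is `q_{T'} ⊗ β`; write `b = β(u,u)`. If the
adjunction `Φᴿ ∘ Φ = N · id` holds on `T(M)` (`N = 1` fully faithful, `N = 2` for a `ℙ¹`-functor), then
`r₀ · b = N`: the square class of `β(u,u)·N` decides whether `M` is isogenous (`[1]`) or a TWIN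
(`[2]`) of `S'`. -/
theorem conformalFactor {K V W : Type*} [Field K] [AddCommGroup V] [Module K V]
    [AddCommGroup W] [Module K W] (BM : LinearMap.BilinForm K V) (B' : LinearMap.BilinForm K W)
    (ψ₀ : V →ₗ[K] W) (r₀ b N : K)
    (hψ : ∀ x y, B' (ψ₀ x) (ψ₀ y) = r₀ * BM x y)
    (hΦ : ∀ x y, B' (ψ₀ x) (ψ₀ y) * b = N * BM x y)
    (x y : V) (hxy : BM x y ≠ 0) : r₀ * b = N := by
  have h := hΦ x y
  rw [hψ x y] at h
  have : (r₀ * b - N) * BM x y = 0 := by linear_combination h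
  rcases mul_eq_zero.mp this with h0 | h0
  · linear_combination h0
  · exact absurd h0 hxy

/-- The `T(S')`-isotypic Mukai form of `S'^{[2]}` (`S'` of degree `2e`, `ρ(S') = 1`) on the
4-dimensional multiplicity space with basis `ι(x), ι(x)h, ι(x)δ, ι(x)δ²`:
`β(u) = 4u₀u₃ + 2e·u₁² − 2u₂²` (from `∫αβγε = q(α,β)q(γ,ε)+q(α,γ)q(β,ε)+q(α,ε)q(β,γ)`, Fujiki
constant 3, and the sign `(−1)^i` of the Mukai dual on `H^{2i}`). It is `H ⊥ ⟨2e, −2⟩`: isotropic. -/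
def betaForm (e : ℚ) (u : Fin 4 → ℚ) : ℚ := 4 * u 0 * u 3 + 2 * e * (u 1) ^ 2 - 2 * (u 2) ^ 2

/-- `β` represents both square classes `1` and `2` (no numerical obstruction to twin-type moduli,
in contrast with the trianalytic-`K3` conic obstruction and the 2-adic obstruction to
`D(S×S) ≃ D(S'×S')` recorded in TRIAGE-r1). -/
theorem betaForm_represents_one_and_two (e : ℚ) :
    betaForm e ![1, 0, 0, 1/4] = 1 ∧ betaForm e ![1, 0, 0, 1/2] = 2 := by
  simp [betaForm]
  norm_num

end Summit.HodgeConjecture.HodgeConjecture.Cruxes.TwinSimilitudeAlgebraic.PfisterSquare
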